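import Mathlib
import Summits.NavierStokesRegularity.NavierStokesRegularity.Theses.TypeIIInviscidRelaxation
import Literature.Analysis.FluidPDE.AxisymmetricEuler

/-!
# Birth skeleton of the piece `OneSidedRadialCriterion` (X₁; route item stmt-NavierStokesRegularity-19059)
of the decomposition of the crux `AxisymSwirlRegular` (stmt-NavierStokesRegularity-1964).

LINE "component upgrade to the KNSS two-sided hypothesis": under the one-sided inflow bound
`r u_r ≥ −Cν` on an axis tube, upgrade to the two-sided scale-critical bound `r|u| ≤ C'` near the axis
component by component — the swirl component is free (`|Γ| = r|u_θ| ≤ ‖Γ₀‖_∞`, maximum principle),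
the open content is the AXIAL component (`stub_axialBound_of_inflowBound`: a bounded-inflow flow cannot
feed an axial jet of unbounded local Reynolds number) and the OUTFLOW (`stub_outflowBound_of_inflowBound`);
then the near-axis form of KNSS 2009 Thm 5.3 / Seregin–Šverák 2009 Thm 1.2 (`stub_knssLocal_components`,
known mathematics; the global-hypothesis form is the tree theorem `knss_no_axisymmetric_typeI_holds`)
continues the solution past `T`.

`OneSidedRadialCriterion_of` is proved from the four stub statements (sorries only inside `stub_*`).
-/

namespace Summit.NavierStokesRegularity.NavierStokesRegularity.Cruxes.AxisymSwirlRegular.OneSidedRadialCriterionBirth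

open Literature.Analysis.FluidPDE Set

/-- The piece X₁ (verbatim the route item stmt-NavierStokesRegularity-19059). -/
def OneSidedRadialCriterion : Prop :=
  ∀ (ν T : ℝ), 0 < ν → 0 < T → ∀ (u : ℝ → EuclideanSpace ℝ (Fin 3) → EuclideanSpace ℝ (Fin 3)) (p : ℝ → EuclideanSpace ℝ (Fin 3) → ℝ), Literature.Analysis.FluidPDE.IsClassicalNSSolutionOn (Set.Ico 0 T) ν 0 u p → Literature.Analysis.FluidPDE.IsLerayHopfOn T ν 0 (u 0) u → (∀ T' < T, ∃ M : ℝ, ∀ t ∈ Set.Icc 0 T', ∀ x, ‖u t x‖ ≤ M) → (∀ t ∈ Set.Ico 0 T, Literature.Analysis.FluidPDE.IsAxisymmetric (u t)) → Literature.Analysis.FluidPDE.HasRapidSpatialDecay (u 0) → (∃ C δ : ℝ, 0 < δ ∧ ∀ t ∈ Set.Ico 0 T, ∀ x, Literature.Analysis.FluidPDE.cylRadius x < δ → -(C * ν) ≤ x 0 * u t x 0 + x 1 * u t x 1) → Literature.Analysis.FluidPDE.HasSmoothExtensionPast ν 0 u T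

/-- **S1 (OPEN, the content): axial-jet bound from the inflow bound.** In the standing class, a
one-sided inflow bound `r u_r ≥ −Cν` on an axis tube forces a two-sided scale-critical bound on the
AXIAL velocity near the axis, `r |u_z| ≤ C₁` on a (smaller) tube up to `T`. Heuristic: by
incompressibility an axial jet of speed `V` and width `ℓ` fed over a length `≈ ℓ` needs radial inflow
flux `≈ Vℓ²`, while the hypothesis caps the inflow flux per unit length by `2πCν`; so `Vℓ ≲ Cν`.
Why it might fail: a jet fed over a long stretch `L ≫ ℓ` of the axis (`Vℓ/ν ≈ C L/ℓ`). -/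
theorem stub_axialBound_of_inflowBound :
    ∀ (ν T : ℝ), 0 < ν → 0 < T → ∀ (u : ℝ → EuclideanSpace ℝ (Fin 3) → EuclideanSpace ℝ (Fin 3)) (p : ℝ → EuclideanSpace ℝ (Fin 3) → ℝ), Literature.Analysis.FluidPDE.IsClassicalNSSolutionOn (Set.Ico 0 T) ν 0 u p → Literature.Analysis.FluidPDE.IsLerayHopfOn T ν 0 (u 0) u → (∀ T' < T, ∃ M : ℝ, ∀ t ∈ Set.Icc 0 T', ∀ x, ‖u t x‖ ≤ M) → (∀ t ∈ Set.Ico 0 T, Literature.Analysis.FluidPDE.IsAxisymmetric (u t)) → Literature.Analysis.FluidPDE.HasRapidSpatialDecay (u 0) → (∃ C δ : ℝ, 0 < δ ∧ ∀ t ∈ Set.Ico 0 T, ∀ x, Literature.Analysis.FluidPDE.cylRadius x < δ → -(C * ν) ≤ x 0 * u t x 0 + x 1 * u t x 1) → ∃ C₁ δ₁ : ℝ, 0 < δ₁ ∧ ∀ t ∈ Set.Ico 0 T, ∀ x, Literature.Analysis.FluidPDE.cylRadius x < δ₁ → Literature.Analysis.FluidPDE.cylRadius x * |u t x 2| ≤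 C₁ := by
  sorry

/-- **S2 (OPEN): outflow bound from the inflow bound.** In the standing class, `r u_r ≥ −Cν` on an axis
tube forces `r u_r ≤ C₂` on a (smaller) tube up to `T` (radial OUTFLOW at most critical). Heuristic:
outflow near the axis is fed by axial convergence, which S1-type control and incompressibility bound;
independently, outflow transports swirl away from the axis and is the depleting (regularising)
direction in the `Γ`-equation. Why it might fail: an outward burst driven by an axial collision of two
jets (stagnation-point flow `u_r ≈ αr/2`, `u_z ≈ −αz` with `α ↑ ∞`). -/
theorem stub_outflowBound_of_inflowBound :
    ∀ (ν T : ℝ), 0 < ν → 0 < T → ∀ (u : ℝ → EuclideanSpace ℝ (Fin 3) → EuclideanSpace ℝ (Fin 3)) (p : ℝ → EuclideanSpace ℝ (Fin 3) → ℝ), Literature.Analysis.FluidPDE.IsClassicalNSSolutionOn (Set.Ico 0 T) ν 0 u p → Literature.Analysis.FluidPDE.IsLerayHopfOn T ν 0 (u 0) u → (∀ T' < T, ∃ M : ℝ, ∀ t ∈ Set.Icc 0 T', ∀ x, ‖u t x‖ ≤ M) → (∀ t ∈ Set.Ico 0 T, Literature.Analysis.FluidPDE.IsAxisymmetric (u t))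 → Literature.Analysis.FluidPDE.HasRapidSpatialDecay (u 0) → (∃ C δ : ℝ, 0 < δ ∧ ∀ t ∈ Set.Ico 0 T, ∀ x, Literature.Analysis.FluidPDE.cylRadius x < δ → -(C * ν) ≤ x 0 * u t x 0 + x 1 * u t x 1) → ∃ C₂ δ₂ : ℝ, 0 < δ₂ ∧ ∀ t ∈ Set.Ico 0 T, ∀ x, Literature.Analysis.FluidPDE.cylRadius x < δ₂ → x 0 * u t x 0 + x 1 * u t x 1 ≤ C₂ := by
  sorry

/-- **S3 (KNOWN, maximum principle for the swirl): `|Γ(t,x)| ≤ B` up to `T`.** `Γ = swirl (u t) =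
x₀u₁ − x₁u₀ = r u_θ` solves `(∂ₜ + b·∇ − νΔ + (2ν/r)∂ᵣ)Γ = 0` and obeys the maximum principle
`‖Γ(t)‖_∞ ≤ ‖Γ₀‖_∞` (KNSS 2009 (1.9); Chae–Lee 2002), `Γ₀` being bounded for a rapidly decaying datum.
In tree: the local `L^{10/3} → L^∞` form `LeiZhang2011.abs_swirl_le_local_of_classical`; the global
form in the standing class is routine but not yet landed. -/
theorem stub_swirlBound :
    ∀ (ν T : ℝ), 0 < ν → 0 < T → ∀ (u : ℝ → EuclideanSpace ℝ (Fin 3) → EuclideanSpace ℝ (Fin 3)) (p : ℝ → EuclideanSpace ℝ (Fin 3) → ℝ), Literature.Analysis.FluidPDE.IsClassicalNSSolutionOn (Set.Ico 0 T) ν 0 u p → Literature.Analysis.FluidPDE.IsLerayHopfOn T ν 0 (u 0) u → (∀ T' < T, ∃ M : ℝ, ∀ t ∈ Set.Icc 0 T', ∀ x, ‖u t x‖ ≤ M) → (∀ t ∈ Set.Ico 0 T, Literature.Analysis.FluidPDE.IsAxisymmetric (u t)) → Literature.Analysis.FluidPDE.HasRapidSpatialDecay (u 0) → ∃ B : ℝ,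 ∀ t ∈ Set.Ico 0 T, ∀ x, |Literature.Analysis.FluidPDE.swirl (u t) x| ≤ B := by
  sorry

/-- **S4 (KNOWN MATHEMATICS, not yet in tree in this local, componentwise form): the near-axis KNSS
criterion.** In the standing class, two-sided bounds near the axis on the three cylindrical components —
`|r u_r| ≤ A`, `|Γ| ≤ B`, `r|u_z| ≤ D` on `{cylRadius < δ'} × [0,T)` — give `r|u| ≤ √(A²+B²+D²)`
there (`r²(u₀²+u₁²) = (x₀u₀+x₁u₁)² + Γ²`), and the solution extends smoothly past `T`: KNSS 2009
Thm 5.3 with the localisation of Seregin–Šverák 2009 Thm 1.2 (axis points), off-axis partial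
regularity of axisymmetric suitable solutions (Caffarelli–Kohn–Nirenberg; tree
`SereginSverakOffAxis*`) and the far field (tree `KatoFarFieldBound`); the global-hypothesis version
is the tree theorem `knss_no_axisymmetric_typeI_holds`. -/
theorem stub_knssLocal_components :
    ∀ (ν T : ℝ), 0 < ν → 0 < T → ∀ (u : ℝ → EuclideanSpace ℝ (Fin 3) → EuclideanSpace ℝ (Fin 3)) (p : ℝ → EuclideanSpace ℝ (Fin 3) → ℝ), Literature.Analysis.FluidPDE.IsClassicalNSSolutionOn (Set.Ico 0 T) ν 0 u p → Literature.Analysis.FluidPDE.IsLerayHopfOn T ν 0 (u 0) u → (∀ T' < T, ∃ M : ℝ, ∀ t ∈ Set.Icc 0 T', ∀ x, ‖u t x‖ ≤ M) → (∀ t ∈ Set.Ico 0 T, Literature.Analysis.FluidPDE.IsAxisymmetric (u t)) → Literature.Analysis.FluidPDE.HasRapidSpatialDecay (u 0) → (∃ A B D δ' : ℝ, 0 < δ' ∧ ∀ t ∈ Set.Ico 0 T, ∀ x, Literature.Analysis.FluidPDE.cylRadius x < δ' → |x 0 * u t x 0 + x 1 * u t x 1| ≤ A ∧ |Literature.Analysis.FluidPDE.swirl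 (u t) x| ≤ B ∧ Literature.Analysis.FluidPDE.cylRadius x * |u t x 2| ≤ D) → Literature.Analysis.FluidPDE.HasSmoothExtensionPast ν 0 u T := by
  sorry

/-- **The piece from the stubs.** Combine the inflow hypothesis (lower bound on `r u_r`) with the
outflow stub S2 (upper bound), the swirl bound S3 and the axial bound S1 on the common tube
`{cylRadius < min δ (min δ₁ δ₂)}`, and apply the near-axis KNSS criterion S4. -/
theorem OneSidedRadialCriterion_of : OneSidedRadialCriterion := by
  intro ν T hν hT u p hcl hLH hbd hax hdec hin
  obtain ⟨C₁, δ₁, hδ₁, haxial⟩ :=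
    stub_axialBound_of_inflowBound ν T hν hT u p hcl hLH hbd hax hdec hin
  obtain ⟨C₂, δ₂, hδ₂, hout⟩ :=
    stub_outflowBound_of_inflowBound ν T hν hT u p hcl hLH hbd hax hdec hin
  obtain ⟨B, hB⟩ := stub_swirlBound ν T hν hT u p hcl hLH hbd hax hdec
  obtain ⟨C, δ, hδ, hin'⟩ := hin
  refine stub_knssLocal_components ν T hν hT u p hcl hLH hbd hax hdec
    ⟨max (|C| * ν) |C₂|, B, C₁, min δ (min δ₁ δ₂), lt_min hδ (lt_min hδ₁ hδ₂), ?_⟩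
  intro t ht x hx
  have hxδ : Literature.Analysis.FluidPDE.cylRadius x < δ := lt_of_lt_of_le hx (min_le_left _ _)
  have hxδ₁ : Literature.Analysis.FluidPDE.cylRadius x < δ₁ :=
    lt_of_lt_of_le hx ((min_le_right _ _).trans (min_le_left _ _))
  have hxδ₂ : Literature.Analysis.FluidPDE.cylRadius x < δ₂ :=
    lt_of_lt_of_le hx ((min_le_right _ _).trans (min_le_right _ _))
  refine ⟨?_, hB t ht x, haxial t ht x hxδ₁⟩
  have hlo := hin' t ht x hxδ
  have hhi := hout t ht x hxδ₂
  have h1 : C * ν ≤ max (|C| * ν) |C₂| :=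
    (mul_le_mul_of_nonneg_right (le_abs_self C) hν.le).trans (le_max_left _ _)
  have h2 : C₂ ≤ max (|C| * ν) |C₂| := (le_abs_self C₂).trans (le_max_right _ _)
  rw [abs_le]
  constructor <;> linarith

end Summit.NavierStokesRegularity.NavierStokesRegularity.Cruxes.AxisymSwirlRegular.OneSidedRadialCriterionBirth
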